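import Literature.Geometry.Lorentzian.CoordMomentumPairingIntegral
import Literature.Geometry.Lorentzian.CoordBoundaryCoercivityIntegrals
import HarnessLib

/-!
# The integrated Green identity for the full linearised constraint map:
# `∫ √g (N·DH(γ,κ) + DM(γ,κ)(X)) = ∫ √g (⟨γ, R_G(N,X)⟩ + ⟨κ, R_K(N,X)⟩)`

Topic `Literature/Geometry/Lorentzian`, coordinate tensor calculus `MetricCoord`. Everything here is
PROVED; no definition and no statement of `Prop` type is introduced.

For `G` Riemannian on an open `V`, smooth symmetric `K, γ, κ` on `V` and a lapse–shift multiplier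
`(N, X)` smooth on `V` with compact support inside `V`, the pointwise Green identity
`IsMetricOn.linConstraint_pairing_eq_sym` (`CoordConstraintAdjoint.lean`),
`N·DH(γ,κ) + DM(γ,κ)(X) = ⟨γ, DH*_γN + DM*ˢ_γX⟩ + ⟨κ, DH*_κN + DM*ˢ_κX⟩ + div(B_N(γ) + C_X)`,
integrates (divergence theorem in coordinates, `CoordDivergenceIntegral.lean`) to

* **`IsMetricOn.integral_linConstraint_pairing_eq`** —
  `∫ √g (N·DH(γ,κ) + DM(γ,κ)(X)) dμ = ∫ √g (⟨γ, adjHamG N + adjMomGS X⟩ + ⟨κ, adjHamK N + adjMomKS X⟩) dμ`.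

This is the distributional characterisation of the KID operator `P* = DΦ*`: a pair `(N, X)` is in
the kernel of `P*` iff it annihilates `DΦ(γ, κ)` for all compactly supported `(γ, κ)`
(Moncrief 1975; Chruściel–Delay 2003, §2), the form in which kernel elements arise as weak limits
in the compactness argument behind the coercivity inequality (3.5) (Prop. 3.3).

Also: `IsMetricOn.contDiffOn_divFormVec`, `IsMetricOn.contDiffOn_greenVec` (smoothness of the
`DS`-boundary field), `greenVec_eq_zero_of_eventuallyEq`, `momGreenVec_eq_zero_of_eq_zero`.

## References

* P. T. Chruściel, E. Delay, Mém. Soc. Math. Fr. 94 (2003), §2 (the operators `P`, `P*`).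
  [ChruscielDelay2003]
* V. Moncrief, J. Math. Phys. 16 (1975), 493–498, §III. [Moncrief1975]
-/

noncomputable section

open Set Filter ContinuousLinearMap Module MeasureTheory Function
open scoped Topology ContDiff

namespace Literature.Geometry.Lorentzian

namespace MetricCoord

variable {E : Type*} [NormedAddCommGroup E] [NormedSpace ℝ E] [FiniteDimensional ℝ E]
  [CompleteSpace E] {G : E → E →L[ℝ] E →L[ℝ] ℝ} {V : Set E} {x : E}
  {ι : Type*} [Fintype ι] (b : Basis ι ℝ E)

/-! ### Smoothness and vanishing of the boundary fields -/

/-- The vector field `(div_G β)^♯` of a smooth field of forms is smooth on `V`. [folklore] -/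
theorem IsMetricOn.contDiffOn_divFormVec (hG : IsMetricOn G V) {β : E → E →L[ℝ] E →L[ℝ] ℝ}
    (hβ : ContDiffOn ℝ ∞ β V) : ContDiffOn ℝ ∞ (divFormVec b G β) V := by
  have h : divFormVec b G β = fun y ↦
      ∑ k, ∑ l, ginv G b y k l • sharpAt G y (cov₂At G β y (b k) (b l)) := rfl
  rw [h]
  refine ContDiffOn.sum fun k _ ↦ ContDiffOn.sum fun l _ ↦ ?_
  exact (hG.contDiffOn_ginv b k l).smul (hG.contDiffOn_sharpAt.clm_apply
    (((hG.contDiffOn_cov₂At hβ).clm_apply contDiffOn_const).clm_apply contDiffOn_const))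

/-- **The `DS`-boundary field `greenVec b G N γ` is smooth on `V`** for `N`, `γ` smooth on `V`.
[folklore] -/
theorem IsMetricOn.contDiffOn_greenVec (hG : IsMetricOn G V) {N : E → ℝ} (hN : ContDiffOn ℝ ∞ N V)
    {γ : E → E →L[ℝ] E →L[ℝ] ℝ} (hγ : ContDiffOn ℝ ∞ γ V) :
    ContDiffOn ℝ ∞ (greenVec b G N γ) V := by
  have h : greenVec b G N γ = fun y ↦
      N y • (divFormVec b G γ y - sharpAt G y (fderiv ℝ (fun z ↦ mtrAt G z (γ z)) y))
        - sharpAt G y (γ y (sharpAt G y (fderiv ℝ N y)))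
        + mtrAt G y (γ y) • sharpAt G y (fderiv ℝ N y) := rfl
  rw [h]
  have hS := hG.contDiffOn_sharpAt
  have hdN : ContDiffOn ℝ ∞ (fderiv ℝ N) V := hN.fderiv_of_isOpen hG.isOpen (by simp)
  have hdtr : ContDiffOn ℝ ∞ (fderiv ℝ (fun z ↦ mtrAt G z (γ z))) V :=
    (hG.contDiffOn_mtrAt hγ).fderiv_of_isOpen hG.isOpen (by simp)
  have hgradN : ContDiffOn ℝ ∞ (fun y ↦ sharpAt G y (fderiv ℝ N y)) V := hS.clm_apply hdN
  have h1 : ContDiffOn ℝ ∞ (fun y ↦ N y • (divFormVec b G γ y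
      - sharpAt G y (fderiv ℝ (fun z ↦ mtrAt G z (γ z)) y))) V :=
    hN.smul ((hG.contDiffOn_divFormVec b hγ).sub (hS.clm_apply hdtr))
  have h2 : ContDiffOn ℝ ∞ (fun y ↦ sharpAt G y (γ y (sharpAt G y (fderiv ℝ N y)))) V :=
    hS.clm_apply (hγ.clm_apply hgradN)
  have h3 : ContDiffOn ℝ ∞ (fun y ↦ mtrAt G y (γ y) • sharpAt G y (fderiv ℝ N y)) V :=
    (hG.contDiffOn_mtrAt hγ).smul hgradN
  exact (h1.sub h2).add h3

omit [CompleteSpace E] in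
/-- The `DS`-boundary field vanishes at a point near which `N` vanishes. [folklore] -/
theorem greenVec_eq_zero_of_eventuallyEq {N : E → ℝ} (hN : N =ᶠ[𝓝 x] fun _ ↦ 0)
    (γ : E → E →L[ℝ] E →L[ℝ] ℝ) : greenVec b G N γ x = 0 := by
  have h0 : N x = 0 := hN.self_of_nhds
  have hd : fderiv ℝ N x = 0 := by rw [hN.fderiv_eq, fderiv_fun_const]; rfl
  rw [greenVec, h0, hd]
  simp

omit [CompleteSpace E] in
/-- The `DM`-boundary field vanishes where the vector field does. [folklore] -/
theorem momGreenVec_eq_zero_of_eq_zero {K γ κ : E → E →L[ℝ] E →L[ℝ] ℝ} {X : E → E}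
    (hX : X x = 0) : momGreenVec G K γ κ X x = 0 := by
  simp only [momGreenVec, hX, map_zero, smul_zero, add_zero, sub_self]

/-! ### The integrated identity -/

section Integral

variable [DecidableEq ι] [MeasurableSpace E] [BorelSpace E] (μ : Measure E) [μ.IsAddHaarMeasure]

/-- **The integrated Green identity for the linearised constraint map** `DΦ = (DH, DM)`. For `G`
Riemannian on `V`, smooth symmetric `K, γ, κ` on `V` and `N`, `X` smooth on `V` with compact
support inside `V`,
`∫ √g (N·DH(γ,κ) + DM(γ,κ)(X)) dμ`
`  = ∫ √g (⟨γ, DH*_γ N + DM*ˢ_γ X⟩_G + ⟨κ, DH*_κ N + DM*ˢ_κ X⟩_G) dμ`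
(`= ∫ √g (⟨γ, R_G(N,X)⟩ + ⟨κ, R_K(N,X)⟩)` with the KID-operator rows of the tree): the divergence
of the boundary field `B_N(γ) + C_X`, compactly supported in `V`, integrates to zero. In particular
a KID `(N, X)` annihilates every `DΦ(γ, κ)`, and conversely (Moncrief 1975; Chruściel–Delay 2003,
§2: `P*` is the formal `L²(√g dμ)`-adjoint of `P`). [cite: ChruscielDelay2003, §2]
[cite: Moncrief1975, §III] -/
theorem IsMetricOn.integral_linConstraint_pairing_eq (hG : IsMetricOn G V)
    (hpos : ∀ y ∈ V, ∀ v : E, v ≠ 0 → 0 < G y v v)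
    {K γ κ : E → E →L[ℝ] E →L[ℝ] ℝ} (hK : ContDiffOn ℝ ∞ K V) (hKs : ∀ y ∈ V, ∀ v w, K y v w = K y w v)
    (hγ : ContDiffOn ℝ ∞ γ V) (hγs : ∀ y ∈ V, ∀ v w, γ y v w = γ y w v)
    (hκ : ContDiffOn ℝ ∞ κ V) (hκs : ∀ y ∈ V, ∀ v w, κ y v w = κ y w v)
    {N : E → ℝ} (hN : ContDiffOn ℝ ∞ N V) (hNc : HasCompactSupport N) (hNV : tsupport N ⊆ V)
    {X : E → E} (hX : ContDiffOn ℝ ∞ X V) (hXc : HasCompactSupport X) (hXV : tsupport X ⊆ V) :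
    ∫ x, sqrtDetGram G b x * (N x * linHamFn b G K γ κ x + linMomFn b G K γ κ x (X x)) ∂μ =
      ∫ x, sqrtDetGram G b x *
        (pairAt G x (γ x) (adjHamG G K N x + adjMomGS G K X x)
          + pairAt G x (κ x) (adjHamK G K N x + adjMomKS G X x)) ∂μ := by
  set S : Set E := tsupport N ∪ tsupport X with hSdef
  have hSV : S ⊆ V := union_subset hNV hXV
  have hSc : IsClosed S := (isClosed_tsupport N).union (isClosed_tsupport X)
  have hzero : ∀ x ∉ S, (N =ᶠ[𝓝 x] fun _ ↦ 0) ∧ (X =ᶠ[𝓝 x] fun _ ↦ 0) := fun x hx ↦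
    eventuallyEq_zero_of_notMem_union hx
  -- the boundary field
  set B : E → E := fun y ↦ greenVec b G N γ y + momGreenVec G K γ κ X y with hB
  have hB₁ : ContDiffOn ℝ ∞ (greenVec b G N γ) V := hG.contDiffOn_greenVec b hN hγ
  have hB₂ : ContDiffOn ℝ ∞ (momGreenVec G K γ κ X) V := hG.contDiffOn_momGreenVec hK hγ hκ hX
  have hBs : ContDiffOn ℝ ∞ B V := hB₁.add hB₂
  have hBzero : ∀ x ∉ S, B =ᶠ[𝓝 x] fun _ ↦ 0 := by
    intro x hx
    obtain ⟨hNx, hXx⟩ := hzero x hx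
    -- `N` and `X` vanish on an open neighbourhood of `x`
    obtain ⟨U, hU, hUo, hxU⟩ := mem_nhds_iff.1 (hNx.and hXx)
    filter_upwards [hUo.mem_nhds hxU] with y hy
    have hNy : N =ᶠ[𝓝 y] fun _ ↦ 0 :=
      Filter.eventually_of_mem (hUo.mem_nhds hy) fun z hz ↦ (hU hz).1
    have hXy : X y = 0 := (hU hy).2
    simp [hB, greenVec_eq_zero_of_eventuallyEq b hNy, momGreenVec_eq_zero_of_eq_zero hXy]
  have hBsupp : tsupport B ⊆ S := by
    intro x hx
    by_contra hxS
    exact (notMem_tsupport_iff_eventuallyEq.mpr (hBzero x hxS)) hx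
  have hBc : HasCompactSupport B := (hNc.union hXc).of_isClosed_subset (isClosed_tsupport B)
    hBsupp
  have hBV : tsupport B ⊆ V := hBsupp.trans hSV
  -- pointwise identity on `V`
  have hfh : ∀ x ∈ V, N x * linHamFn b G K γ κ x + linMomFn b G K γ κ x (X x) =
      (pairAt G x (γ x) (adjHamG G K N x + adjMomGS G K X x)
        + pairAt G x (κ x) (adjHamK G K N x + adjMomKS G X x)) + divAt G B x := by
    intro x hx
    have hys := hG.mem_nhds hx
    have hd₁ : DifferentiableAt ℝ (greenVec b G N γ) x :=
      ((hB₁ x hx).contDiffAt hys).differentiableAt (by simp)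
    have hd₂ : DifferentiableAt ℝ (momGreenVec G K γ κ X) x :=
      ((hB₂ x hx).contDiffAt hys).differentiableAt (by simp)
    rw [hB, divAt_add hd₁ hd₂]
    exact hG.linConstraint_pairing_eq_sym b hx hK hKs hγ hγs hκ hκs hN hX
  -- vanishing off `V`
  have hlin0 : ∀ x, linMomFn b G K γ κ x 0 = 0 := fun x ↦ by
    simpa using linMomFn_smul b K γ κ x 0 (0 : E) (G := G)
  have hf : ∀ x ∉ V, N x * linHamFn b G K γ κ x + linMomFn b G K γ κ x (X x) = 0 := by
    intro x hx
    have hxS : x ∉ S := fun h ↦ hx (hSV h)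
    obtain ⟨hNx, hXx⟩ := hzero x hxS
    rw [hNx.self_of_nhds, hXx.self_of_nhds, zero_mul, zero_add, hlin0]
  have hrows : ∀ x ∉ S, adjHamK G K N x + adjMomKS G X x = 0 ∧
      adjHamG G K N x + adjMomGS G K X x = 0 := fun x hx ↦ by
    obtain ⟨hNx, hXx⟩ := hzero x hx
    obtain ⟨h1, h2, -⟩ := kidRows_eq_zero_of_eventuallyEq (G := G) (K := K) hNx hXx
    exact ⟨h1, h2⟩
  have hh0 : ∀ x ∉ S, pairAt G x (γ x) (adjHamG G K N x + adjMomGS G K X x)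
      + pairAt G x (κ x) (adjHamK G K N x + adjMomKS G X x) = 0 := fun x hx ↦ by
    rw [(hrows x hx).1, (hrows x hx).2]
    simp [pairAt_apply]
  have hh : ∀ x ∉ V, pairAt G x (γ x) (adjHamG G K N x + adjMomGS G K X x)
      + pairAt G x (κ x) (adjHamK G K N x + adjMomKS G X x) = 0 :=
    fun x hx ↦ hh0 x fun h ↦ hx (hSV h)
  -- integrability of `√g h`: continuous with compact support
  have hsm : ContDiffOn ℝ ∞ (fun x ↦ sqrtDetGram G b x *
      (pairAt G x (γ x) (adjHamG G K N x + adjMomGS G K X x)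
        + pairAt G x (κ x) (adjHamK G K N x + adjMomKS G X x))) V :=
    (hG.contDiffOn_sqrtDetGram b hpos).mul
      ((hG.contDiffOn_pairAt hγ ((hG.contDiffOn_adjHamG hK hN).add (hG.contDiffOn_adjMomGS hK hX))).add
        (hG.contDiffOn_pairAt hκ ((hG.contDiffOn_adjHamK hK hN).add (hG.contDiffOn_adjMomKS hX))))
  have hhc : Continuous fun x ↦ sqrtDetGram G b x *
      (pairAt G x (γ x) (adjHamG G K N x + adjMomGS G K X x)
        + pairAt G x (κ x) (adjHamK G K N x + adjMomKS G X x)) := by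
    rw [continuous_iff_continuousAt]
    intro x
    by_cases hx : x ∈ S
    · have hxV := hSV hx
      exact (hsm.continuousOn.continuousWithinAt hxV).continuousAt (hG.mem_nhds hxV)
    · have h0 : (fun x ↦ sqrtDetGram G b x *
          (pairAt G x (γ x) (adjHamG G K N x + adjMomGS G K X x)
            + pairAt G x (κ x) (adjHamK G K N x + adjMomKS G X x))) =ᶠ[𝓝 x] fun _ ↦ 0 := by
        filter_upwards [hSc.isOpen_compl.mem_nhds hx] with y hy
        rw [hh0 y hy, mul_zero]
      exact continuousAt_const.congr_of_eventuallyEq h0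
  have hhsupp : HasCompactSupport fun x ↦ sqrtDetGram G b x *
      (pairAt G x (γ x) (adjHamG G K N x + adjMomGS G K X x)
        + pairAt G x (κ x) (adjHamK G K N x + adjMomKS G X x)) := by
    refine (hNc.union hXc).of_isClosed_subset (isClosed_tsupport _) ?_
    refine closure_minimal (fun x hx ↦ ?_) hSc
    by_contra hxS
    exact hx (show sqrtDetGram G b x * _ = 0 by rw [hh0 x hxS, mul_zero])
  have hhi : Integrable (fun x ↦ sqrtDetGram G b x *
      (pairAt G x (γ x) (adjHamG G K N x + adjMomGS G K X x)
        + pairAt G x (κ x) (adjHamK G K N x + adjMomKS G X x))) μ :=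
    hhc.integrable_of_hasCompactSupport hhsupp
  exact hG.integral_sqrtDetGram_mul_eq_of_eq_add_divAt b μ hpos hBs hBc hBV hfh hf hh hhi

/-- **A KID annihilates the linearised constraints of every compactly supported variation-pairing**:
if `(N, X)` is a KID of `(G, K)` on `V` (`adjHamG N + adjMomGS X = 0 = adjHamK N + adjMomKS X`),
smooth with compact support in `V`, then `∫ √g (N·DH(γ,κ) + DM(γ,κ)(X)) dμ = 0` for all smooth
symmetric `γ, κ` on `V`. [cite: ChruscielDelay2003, §2] [cite: Moncrief1975, §III] -/
theorem IsMetricOn.integral_linConstraint_pairing_eq_zero_of_kid (hG : IsMetricOn G V)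
    (hpos : ∀ y ∈ V, ∀ v : E, v ≠ 0 → 0 < G y v v)
    {K γ κ : E → E →L[ℝ] E →L[ℝ] ℝ} (hK : ContDiffOn ℝ ∞ K V) (hKs : ∀ y ∈ V, ∀ v w, K y v w = K y w v)
    (hγ : ContDiffOn ℝ ∞ γ V) (hγs : ∀ y ∈ V, ∀ v w, γ y v w = γ y w v)
    (hκ : ContDiffOn ℝ ∞ κ V) (hκs : ∀ y ∈ V, ∀ v w, κ y v w = κ y w v)
    {N : E → ℝ} (hN : ContDiffOn ℝ ∞ N V) (hNc : HasCompactSupport N) (hNV : tsupport N ⊆ V)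
    {X : E → E} (hX : ContDiffOn ℝ ∞ X V) (hXc : HasCompactSupport X) (hXV : tsupport X ⊆ V)
    (hkid : ∀ y ∈ V, adjHamG G K N y + adjMomGS G K X y = 0 ∧ adjHamK G K N y + adjMomKS G X y = 0) :
    ∫ x, sqrtDetGram G b x * (N x * linHamFn b G K γ κ x + linMomFn b G K γ κ x (X x)) ∂μ = 0 := by
  rw [hG.integral_linConstraint_pairing_eq b μ hpos hK hKs hγ hγs hκ hκs hN hNc hNV hX hXc hXV]
  refine integral_eq_zero_of_ae (Eventually.of_forall fun x ↦ ?_)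
  show sqrtDetGram G b x * _ = 0
  by_cases hx : x ∈ V
  · rw [(hkid x hx).1, (hkid x hx).2]; simp [pairAt_apply]
  · have hxS : x ∉ tsupport N ∪ tsupport X := fun h ↦ hx (union_subset hNV hXV h)
    obtain ⟨hNx, hXx⟩ := eventuallyEq_zero_of_notMem_union hxS
    obtain ⟨h1, h2, -⟩ := kidRows_eq_zero_of_eventuallyEq (G := G) (K := K) hNx hXx
    rw [h1, h2]; simp [pairAt_apply]

end Integral

end MetricCoord

end Literature.Geometry.Lorentzian

end
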